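import Summits.QuantumAdvantage.QuantumAdvantage.Theorems.NearExactIsExact.Negative.TypeTFalseFourteen
import Summits.QuantumAdvantage.QuantumAdvantage.Theorems.NearExactIsExact.Negative.LevelSixFullSixtyOne

/-!
# `61/64` is not a value: `θ₁₄ < 61/64` (NearExactIsExact, disprover gen 24)

Negative/structural theorem for the crux `CubicForrelation.NearExactIsExact` (item r2), finite slice `n = 14`.
HONEST FRAMING: a statement about cubic Boolean functions on 14 bits — NOT summit progress; no violation of `NearExactIsExact`
(whose content is uniformity of the gap in `n`), and no information about any other `n`.

* `ge_61_is_exact`: for cubic `f, g : F₂¹⁴ → F₂`, `Φ(f,g) ≥ 61/64 ⇒ Φ(f,g) = 1`.  Assembly of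
  `levelSix_false_61c` (no level-6 side at `Φ ≥ 61/64`, `…Negative.LevelSixFullSixtyOne`), hence both sides are of type O
  (`both_typeO_of_ge_61`), and `typeT_pair_false` (no such pair, `…Negative.TypeTFalseFourteen`).
* `exact_or_lt_61`: every cubic pair on 14 bits has `Φ = 1` or `Φ < 61/64`; with the tree's `61/64`-isolation theorem this
  sharpens `θ₁₄ ≤ 61/64` (`theta_fourteen_window_61`) to the strict `θ₁₄ < 61/64`.
* `exists_theta_lt_61_fourteen`: the `n = 14` instance of the near-exact ⇒ exact phenomenon holds with some threshold
  `θ < 61/64` (finiteness; the true value of `θ₁₄` is not determined here — the best non-exact pair known on 14 bits has `Φ = 57/64`).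
Sources: [this work].  Standard axioms only. -/

set_option linter.dupNamespace false -- D-0017: single-problem summit ⇒ `QuantumAdvantage.QuantumAdvantage` by design

noncomputable section

namespace Summit.QuantumAdvantage.QuantumAdvantage.Theorems.NearExactIsExact.Negative.SixtyOneNotAttainedFourteen

open Finset
open Literature.Computability.QuantumComplexity
open Summit.QuantumAdvantage.QuantumAdvantage.Theorems.NearExactIsExact.Negative.TypeTFalseFourteen (typeT_pair_false)
open Summit.QuantumAdvantage.QuantumAdvantage.Theorems.NearExactIsExact.Negative.LevelSixFullSixtyOne (both_typeO_of_ge_61)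

/-- **THEOREM (`61/64 ⇒ exact`).**  For cubic `f, g` on 14 bits, `Φ(f,g) ≥ 61/64` implies `Φ(f,g) = 1`.
Finite-slice statement at `n = 14`; NOT summit progress. [this work] -/
theorem ge_61_is_exact (f g : (Fin (7 + 7) → Bool) → Bool) (hf : IsDegLeFun 3 f) (hg : IsDegLeFun 3 g)
    (hΦ : (61 / 64 : ℝ) ≤ forrelation f g) : forrelation f g = 1 := by
  by_contra hne
  obtain ⟨⟨u, hu, hou⟩, ⟨v, hv, hov⟩⟩ := both_typeO_of_ge_61 f g hf hg hΦ hne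
  exact typeT_pair_false f g hf hg u hu hou v hv hov hΦ

/-- **THEOREM (`θ₁₄ < 61/64`).**  Every cubic pair on 14 bits has `Φ = 1` or `Φ < 61/64`.  NOT summit progress. [this work] -/
theorem exact_or_lt_61 (f g : (Fin (7 + 7) → Bool) → Bool) (hf : IsDegLeFun 3 f) (hg : IsDegLeFun 3 g) :
    forrelation f g = 1 ∨ forrelation f g < 61 / 64 := by
  by_cases h : (61 / 64 : ℝ) ≤ forrelation f g
  · exact Or.inl (ge_61_is_exact f g hf hg h)
  · exact Or.inr (not_le.1 h)

/-- **The `n = 14` slice of near-exact ⇒ exact, with a threshold below `61/64`.**  There is `θ < 61/64` such that every cubic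
pair on 14 bits with `Φ > θ` is exact (finiteness of the value set and `exact_or_lt_61`; the value of `θ₁₄ ∈ [57/64, 61/64)` is NOT determined).
NOT summit progress — `NearExactIsExact` asks for one `θ` for all even `n`. [this work] -/
theorem exists_theta_lt_61_fourteen : ∃ θ : ℝ, θ < 61 / 64 ∧ ∀ f g : (Fin (7 + 7) → Bool) → Bool,
    IsDegLeFun 3 f → IsDegLeFun 3 g → θ < forrelation f g → forrelation f g = 1 := by
  classical
  -- the finitely many values `< 61/64` of cubic pairs
  have hfin : {r : ℝ | r < 61 / 64 ∧ ∃ f g : (Fin (7 + 7) → Bool) → Bool, IsDegLeFun 3 f ∧ IsDegLeFun 3 g ∧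
      forrelation f g = r}.Finite := by
    refine (Set.finite_range (fun p : ((Fin (7 + 7) → Bool) → Bool) × ((Fin (7 + 7) → Bool) → Bool) =>
      forrelation p.1 p.2)).subset ?_
    rintro r ⟨-, f, g, -, -, rfl⟩
    exact ⟨(f, g), rfl⟩
  set S := hfin.toFinset with hS
  have hSlt : ∀ r ∈ S, r < 61 / 64 := fun r hr => ((Set.Finite.mem_toFinset hfin).1 hr).1
  refine ⟨if h : S.Nonempty then S.max' h else 0, ?_, ?_⟩
  · split_ifs with h
    · exact hSlt _ (max'_mem S h)
    · norm_num
  · intro f g hf hg hθ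
    rcases exact_or_lt_61 f g hf hg with h1 | hlt
    · exact h1
    · exfalso
      have hmem : forrelation f g ∈ S := (Set.Finite.mem_toFinset hfin).2 ⟨hlt, f, g, hf, hg, rfl⟩
      have hne : S.Nonempty := ⟨_, hmem⟩
      rw [dif_pos hne] at hθ
      exact absurd (le_max' S _ hmem) (not_le.2 hθ)

end Summit.QuantumAdvantage.QuantumAdvantage.Theorems.NearExactIsExact.Negative.SixtyOneNotAttainedFourteen

end
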